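import Summits.CriticalPhenomena.PercolationContinuityZ3.Theorems.Transplant.SkelFrmFrom1ReachHoldsQ3V
import Summits.CriticalPhenomena.PercolationContinuityZ3.Theorems.Transplant.SkelFrmQuasi1ReachRadQVPxK
import Summits.CriticalPhenomena.PercolationContinuityZ3.Theorems.Transplant.SkelFrmQuasi1ReachRadQUVPxK
import Summits.CriticalPhenomena.PercolationContinuityZ3.Theorems.Transplant.SkelFrmQuasiBChoiceHXVPx
import Summits.CriticalPhenomena.PercolationContinuityZ3.Theorems.Transplant.SkelFrmQuasiBChoiceHYVPx
import Summits.CriticalPhenomena.PercolationContinuityZ3.Theorems.Transplant.SkelFrmQuasiBChoiceSlotsPx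
import Summits.CriticalPhenomena.PercolationContinuityZ3.Theorems.Transplant.SkelFrmQuasiBParamsKitBump
import Summits.CriticalPhenomena.PercolationContinuityZ3.Theorems.Transplant.SkelFrmFrom1ChoiceDefsPx
import Summits.CriticalPhenomena.PercolationContinuityZ3.Theorems.Transplant.PlanarSkeletonFrmQuasiDefs
import Summits.CriticalPhenomena.PercolationContinuityZ3.Theorems.Transplant.SkelFrmQuasi1SlotTypes
import HarnessLib

/-!
# GEN-Q PORT (WAVE-Q table v0.8 section 2, row G247, U-level L?; captain R-6/R-7 2026-08-27: carrier token swap `PlanarSkeletonFrmFrom ↦ PlanarSkeletonFrmQuasi`)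
# of the tree module «Transplant/SkelFrmFrom1ReachHoldsQ3VPx» (sha256 f56195cd32f0187c…) onto the quasi-step carrier `PlanarSkeletonFrmQuasi` (p507026): «SkelFrmQuasi1ReachHoldsQ3VPx»

HAND HUNK (L-FLOORMAP-1 ①⑥ / L-KitS-1 reader side; G017 «SkelFrmQuasiBChoiceNums», hp-8's KitSN): R'0×1, r₀0×2 — the (S0) kit of record at window cost `KS.NQ Φ`.

DEDUP GUARD (stmt-g34, L-stmt34-2): `atQ3V_cells` spells the carrier-qualified head `PlanarSkeletonFrmQuasi.NegB.choiceAtQ3V` so its header text differs from the FrmFrom twin (the gate's textual `dedup.landed`; same device as the U→GEN node file's `PlanarSkeletonFrmFrom.Neg.FSlot`). K-2 DONE (stmt-g34: callees renamed `…fstPxKQ/…sndUPxKQ`; §2 binders `KS.NQ ↦ NegB.KS.NQ` (outside `namespace NegB`); T3 alias `five_le_Kq_of_le`; validated against the staged parents' statements). Was: K-2 TODO (successor; tool + ks_hunks ONLY, UNCHECKED; SPELLING of the corridor slope in my G248/G249 binders `hρ2` is `((Φ.M : ℕ) : ℤ) * (10 + 3) * (…)` — p3/gen-2's slot rows write `Φ.M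 * 13 * x`; bridge with `by push_cast; linarith` or restate): callees `NegB.reachOblAtHNF_frmQ3VR_fstPxK/sndUPxK ↦ …Q` (my G249/G248); their `hρ1/hρ2/hρ3` floors (`r₀0N … + 3 ≤ E₀(SUS)`, `Φ.M·(10+3)·(box) + 4 ≤ E₀(SUS)`) must come from p3's «…BChoiceHXVPx/HYVPx/SlotsPx/KitBump» rows sized ×Φ.M / ×KS.NQ Φ.

ORIGINAL TITLE: 

builds on p205010 (kernel theorem, internal audit signed; external expert review pending) — nothing in this file uses p205010; NOTHING is claimed about any open node
((N3-b), the end state).  Lane `prim-bschramm`, seat `prim-bschramm-stmt` (gen 33; GEN-Q column pen; tool = captain gen-1 g4's port_genq.py R-14 --cone + p3-g30's T1 patch).  Helper file (`--supports stmt-CriticalPhenomena-4575 --as helper`).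
PORT RULES (U-wave r1–r4 re-used, GEN-Q hunk classes of p3-g29 #6136): declaration order, names and proof texts are those of «SkelFrmFrom1ReachHoldsQ3VPx», byte-identical except
(i) the carrier token `PlanarSkeletonFrmFrom ↦ PlanarSkeletonFrmQuasi` in binders, `namespace`/`end` lines and qualified names (module names `SkelFrmFrom… ↦ SkelFrmQuasi…`
in imports of already-ported rows); (ii) `Φ.step ↦ Φ.qstep` with the called Steps lemma replaced by its `…Q`/`_q` twin and the cost `Φ.M` threaded (none in this file unless
listed below); (iii) `Φ.cyl_connected ↦ Φ.cyl_reach` readers (none unless listed); (iv) graph-ball radii / window floors ×`Φ.M` (none unless listed).  Carrier-free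
residents stay imported/exported from the original «SkelFrm1ReachHoldsQ3VPx» exactly as in the FrmFrom port.  Docstrings and citations are the original's.

-/

open scoped Classical

noncomputable section

namespace Summit.CriticalPhenomena.PercolationContinuityZ3.Theorems.Transplant

namespace PlanarSkeletonFrmQuasi

export PlanarSkeletonFrm (five_le_Kq_of_le)  -- T3: resident alias replicated from the FrmFrom namespace («SkelFrmFrom1ReachHoldsQ3V» :52)

open Literature.Probability.Percolation Literature.Probability.LatticeModels SimpleGraph GadgetSystem ProbeHistory HSiteScheme Contour KNCells
open KNCells.KSchA KNLevels
open Literature.Barriers.CriticalPhenomena (HasExponentialGrowth graphBall)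
open Skel (ReachOblAtHNF excess)
open SkelConc (Consts)
open Skelφ.StepI (DataN DataNS OutNS)

/-! ## §1 `AtQNQ` does not read the fibre / creep / room / arrival slots -/

namespace NegB

open Neg

variable {κ : Consts} {V : Type} [DecidableEq V] [Countable V] {G : SimpleGraph V} [G.LocallyFinite] {Φ : PlanarSkeletonFrmQuasi G} {t : V} {p : unitInterval}
  {hC : Φ.CylSubcritical p} {gv fv : Neg.FSlot} {Pv : PSlot} {Sv Sv' : SSlot} {cv cv' hv hv' : CSlot} {bv bv' : BSlot} {O : OutNS V} {q : unitInterval}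

/-- `AtQNQ` of the V choice data reads only `m₀`, `Sz`, `SMn`, `δI` (slots `Pv`, `gv`, `fv`): the fibre / creep / room / arrival slots are free. [folklore] -/
theorem atQ3V_cells (h : (PlanarSkeletonFrmQuasi.NegB.choiceAtQ3V κ Φ t p Pv gv fv Sv cv hv bv hC).AtQNQ O q) :
    (PlanarSkeletonFrmQuasi.NegB.choiceAtQ3V κ Φ t p Pv gv fv Sv' cv' hv' bv' hC).AtQNQ O q :=
  ⟨h.1, h.2.1, h.2.2.1, h.2.2.2.1, h.2.2.2.2⟩

-- GEN-Q (R-2, captain 2026-08-27): `PlanarSkeletonFrmFrom.NegB.atQ3VPx_cells` is not in the used cone of the node top — not ported.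

end NegB

/-! ## §2 The (C) column target under proxies, slot-robust form -/

/-- **THE (C) COLUMN TARGET OF RECORD UNDER PROXIES, SLOT-ROBUST FORM**: for every proxy radius `D`, every slot tuple whose box slot dominates `gFloorKG`/`40·K·R′0` and
whose excess slot dominates the kit threshold at the long radius `RLD + D` and the x- and y-depth floors — ALL AT THE RAISED KIT INDEX `KS.RK t Dr 0 + D` of the record they
are read at — and every `Kmin ≥ 160`, the GEN choice function of record `frmChoiceAllQ3VPx D gv fv Pv (SUS ex mx) (cvPx D) (hvPx D) BSlot.small3` meets the budgeted
corridor obligation `ReachHoldsRHNQFnLKPxAt NegB.LfQ Kmin`.  (U's `reachHoldsRHNQFnLK_frmChoiceAllQ3V_of_le` read at `mkP`: `HX_QVAtPx`/`HY_QVAtPx` ∘ the K-2 rows ∘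
`Skel.reachOblRHNOF_of_axes`.) [cite: KozmaNitzan2024, §4 Lemma 12, p. 30] -/
theorem reachHoldsRHNQFnLKPxAt_frmChoiceAllQ3VPx_of_le (D Kmin : ℕ) (hKmin : 160 ≤ Kmin) {gv fv : Neg.FSlot} {Pv : NegB.PSlot} {ex mx : NegB.GSlot}
    (Hg : ∀ (κ : Consts) {V : Type} [DecidableEq V] [Countable V] {G : SimpleGraph V} [G.LocallyFinite] (Φ : PlanarSkeletonFrmQuasi G) (t : V) (p : unitInterval)
      (Dr : DataNS V), NegB.gFloorKG κ Φ t p Dr (NegB.KS.RK t Dr 0 + D) ≤ gv κ Φ t p Dr ∧ 40 * Neg.K κ * NegB.KS0.R'0N κ Φ (NegB.KS.NQ Φ) t p Dr (NegB.KS.RK t Dr 0 + D) ≤ gv κ Φ t p Dr)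
    (Hex : ∀ (κ : Consts) {V : Type} [DecidableEq V] [Countable V] {G : SimpleGraph V} [G.LocallyFinite] (Φ : PlanarSkeletonFrmQuasi G) (t : V) (p : unitInterval)
      (Dr : DataNS V) (g f : ℕ), NegB.KS0.r₀0N (NegB.KS.NQ Φ) t Dr (NegB.KS.RK t Dr 0 + D) (NegB.RLD κ Φ t p Dr g f + D) + 3 ≤ ex κ Φ t p Dr g f ∧ NegB.ZD2 κ Φ t p Dr g f + 4 ≤ ex κ Φ t p Dr g f)
    (HexY : ∀ (κ : Consts) {V : Type} [DecidableEq V] [Countable V] {G : SimpleGraph V} [G.LocallyFinite] (Φ : PlanarSkeletonFrmQuasi G) (t : V) (p : unitInterval)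
      (Dr : DataNS V) (g f : ℕ), NegB.KS0.r₀0N (NegB.KS.NQ Φ) t Dr (NegB.KS.RK t Dr 0 + D) (NegB.RLD κ Φ t p Dr g f + D) + 3 ≤ ex κ Φ t p Dr g f ∧ NegB.ZDYW κ Φ t p Dr g f + 4 ≤ ex κ Φ t p Dr g f) :
    ReachHoldsRHNQFnLKPxAt NegB.LfQ Kmin (frmChoiceAllQ3VPx D gv fv Pv (NegB.SUS ex mx) (NegB.cvPx D) (NegB.hvPx D) NegB.BSlot.small3) :=
  fun κ _ _ _ _ _ Φ _ t _ hP p hp0 hp1 hC hK => by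
  show (NegB.choiceAtQ3VPx κ Φ t p D Pv gv fv (NegB.SUS ex mx) (NegB.cvPx D) (NegB.hvPx D) NegB.BSlot.small3 hC).ReachHoldsRHNQL NegB.LfQ
  intro O q hAt
  refine ⟨NegB.LfQ κ.K₀, le_rfl, ?_⟩
  -- K-2: the raised kit index `mkP := RK 0 + D` and its clearance `RK 0 + D ≤ RK mkP`
  have hRK : NegB.KS.RK t O.merged 0 + D ≤ NegB.KS.RK t O.merged (NegB.KS.RK t O.merged 0 + D) :=
    NegB.RK_add_le_RK_raise_of_atQ 0 (NegB.atQ3_of_atQ3VPx hAt)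
  -- the cells of the tuple at `O.merged` ARE `cR2W mkP` / `hFR mkP` (definitionally); `AtQNQ` does not read cells
  have hAt' : (NegB.choiceAtQ3V κ Φ t p Pv gv fv (NegB.SUS ex mx) (NegB.cR2W (NegB.KS.RK t O.merged 0 + D)) (NegB.hFR (NegB.KS.RK t O.merged 0 + D))
      NegB.BSlot.small3 hC).AtQNQ O q := NegB.atQ3V_cells (NegB.atQ3V_of_atQ3VPx hAt)
  -- the cells of the tuple read at `O.merged` ARE `cR2W mkP` / `hFR mkP` (one `rfl` each through «SlotsPx».cvPx_at/hvPx_at — no structure unfolding)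
  have hc : NegB.cOf κ Φ t p O gv fv (NegB.cvPx D) = NegB.cOf κ Φ t p O gv fv (NegB.cR2W (NegB.KS.RK t O.merged 0 + D)) := by
    funext i; exact NegB.cvPx_at κ Φ t p O.merged D _ _ i
  have hh : NegB.hOf κ Φ t p O gv fv (NegB.hvPx D) = NegB.hOf κ Φ t p O gv fv (NegB.hFR (NegB.KS.RK t O.merged 0 + D)) := by
    funext i; exact NegB.hvPx_at κ Φ t p O.merged D _ _ i
  -- the two row bundles at the raised index (pointwise floors, long radius `RL + D`)
  obtain ⟨ρ, qq, W, HK, N, aW, Bx, bL, hρ1, hρ2, hρ3, hPl, hPt, hLl, ha, hBx, hbL, haq, hbW, hN, hLt⟩ :=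
    NegB.HX_QVAtPx (hC := hC) (Pv := Pv) (fv := fv) (mx := mx) (NegB.KS.RK t O.merged 0 + D) D (five_le_Kq_of_le κ hKmin hK) O q hAt'
      (Hg κ Φ t p O.merged).1 (Hg κ Φ t p O.merged).2 (Hex κ Φ t p O.merged _ _).1 (Hex κ Φ t p O.merged _ _).2
  obtain ⟨ρ', qq', W', HK', N', aW', Bx', bL', hρ1', hρ2', hρ3', hPR', hLl', ha', hBx', hbL', haW', haW'', hbq', hN', hLt'⟩ :=
    NegB.HY_QVAtPx (hC := hC) (Pv := Pv) (fv := fv) (mx := mx) (NegB.KS.RK t O.merged 0 + D) D (five_le_Kq_of_le κ hKmin hK) O q hAt'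
      (Hg κ Φ t p O.merged).1 (Hg κ Φ t p O.merged).2 (HexY κ Φ t p O.merged _ _).1 (HexY κ Φ t p O.merged _ _).2
  rw [← hc, ← hh] at hPl hPt hLl hLt hPR' hLl' hLt'
  exact Skel.reachOblRHNOF_of_axes
    (fun h e hrun hcO hV hdu hne => NegB.reachOblAtHNF_frmQ3VR_fstPxKQ hAt hP hp0 hp1 0 O.merged (NegB.KS.RK t O.merged 0 + D) hRK hrun hcO hV hdu hne HK N hρ1 hρ2 hρ3
      hPl hPt hLl (hLt (tgt e)) ha hBx hbL haq hbW hN)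
    (fun h e hrun hcO hV hdu hne => NegB.reachOblAtHNF_frmQ3VR_sndUPxKQ hAt hP hp0 hp1 0 O.merged (NegB.KS.RK t O.merged 0 + D) hRK hrun hcO hV hdu hne HK' N' hρ1' hρ2' hρ3'
      hPR' hLl' (hLt' (tgt e)) ha' hBx' hbL' haW' haW'' hbq' hN')

end PlanarSkeletonFrmQuasi

end Summit.CriticalPhenomena.PercolationContinuityZ3.Theorems.Transplant

end
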